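import Summits.CriticalPhenomena.PercolationContinuityZ3.Theorems.PercNearOneGluingNoHeavyConstsCrossReachMarkerPinnedEvent
import Summits.CriticalPhenomena.PercolationContinuityZ3.Theorems.PercNearOneGluingNoHeavyConstsSourceLocalFourEventsEdge
import HarnessLib

/-!
# CROSS at the marker `u = z`, marker-pinned class for EDGE up-sets: the three exchanges of the `M₂` certificate, and `M₂ ≥ 0` unconditionally
# (PAPER-2 track (ii), seat `prim-consts-2`, gen 21 — edge-cluster companion of `…ConstsCrossReachMarkerPinnedExchanges.lean`)

builds on p205010 (kernel theorem, internal audit signed; external expert review pending).  Support file (`--supports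
stmt-CriticalPhenomena-4575`); theorems only, no sorries, standard axioms.  Memo `run/shared/lean/prim/consts/FROM-prim-consts-2-g21-GIBBS-ORBIT.md` §3c.

`…ConstsCrossReachMarkerPinnedEvent.lean` proves the CROSS member `M₂ ≥ 0` at `u = z` for `F(C_s) = 1_U`, `U ⊆ {s↔y}` an arbitrary configuration event,
from three exchange inequalities `hG1, hG2, hG3`.  This file proves them for `U = {𝒰(C_s)}`, `𝒰` a monotone family of EDGE sets (an up-set of the
open edge cluster) — each is an instance of `Consts.localEvE_fourEvents` (`…ConstsSourceLocalFourEventsEdge.lean`: Ahlswede–Daykin four events under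
avoidance conditioning for predicates on the open edge clusters of the source set `{s, y}`):
* `Consts.pinnedEdge_exchange_G1` — `μ(s↔y, s↮X, 𝒰(C_s))·μ(y↔z, y↮s, {s,y}↮X) ≤ μ(y↮s, s↮z, {s,y}↮X)·μ(s↔y, s↔z, s↮X, 𝒰(C_s))`;
* `Consts.pinnedEdge_exchange_G2` — `μ({s,y}↮X, z ∈ C_s∪C_y)·μ(s↔y, s↮X, 𝒰(C_s)) ≤ μ({s,y}↮X)·μ(s↔y, s↔z, s↮X, 𝒰(C_s))`;
* `Consts.pinnedEdge_exchange_G3` — the same with the decreasing rider `y ↮ s` on the first factor and on the meet;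
* `Consts.crossRel_edge_M2_of_markerPinned` — **THEOREM: `P(X',X',X) + P(X',X,X') + P(X,X',X') ≥ 0` (`X' = X ∪ {z}`) for every weighted graph, all
  `s, y, z, X` and every MONOTONE 0/1-valued functional `F` of the open edge cluster with `F(C_s) = 1 ⟹ s↔y`** — the `u = z` member `M₂` of
  `Consts.CrossRel` on every edge up-set pinned below the marker event, unconditionally (`𝒰 := {F = 1}`, `U := {F(C_s) = 1}`).
[cite: VandenbergHaggstromKahn2005, Thm. 1.1 and its proof (pp. 3–5), Thm. 1.3 (p. 6) with Remark 1 after Thm. 1.2 (p. 5)]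
-/

noncomputable section

namespace Summit.CriticalPhenomena.PercolationContinuityZ3.Theorems

open MeasureTheory Set Finset
open Literature.Probability.LatticeModels (prodBernoulli)
open Literature.Probability.Percolation
open scoped Classical

namespace Consts

variable {V : Type} [DecidableEq V] [Fintype V] (w : Sym2 V → unitInterval)

omit [DecidableEq V] [Fintype V] in
/-- Reachability in the open graph is monotone in the configuration. [folklore] -/
private theorem reach_mono' {ω ω' : BondConfig V} (h : ω ⊆ ω') {u v : V} (huv : (openGraph ω).Reachable u v) :
    (openGraph ω').Reachable u v :=
  huv.mono (BHK2006.openGraph_le h)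

omit [DecidableEq V] [Fintype V] in
/-- The edge-cluster profile at a source. [folklore] -/
private theorem clusterOf_apply' {S : Finset V} {ω : BondConfig V} {v : V} (hv : v ∈ S) :
    clusterOf S ω v = openEdgeCluster ω v := by
  ext e; exact ⟨fun h => h.2, fun h => ⟨hv, h⟩⟩

omit [DecidableEq V] [Fintype V] in
/-- Reachability read off the edge cluster. [cite: VandenbergHaggstromKahn2005, §1 p. 3] -/
private theorem reach_iff' (ω : BondConfig V) (v a : V) :
    (a = v ∨ ∃ e ∈ openEdgeCluster ω v, a ∈ e) ↔ (openGraph ω).Reachable v a :=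
  (reachable_iff_exists_mem_openEdgeCluster ω v a).symm

/-- **Generator `G₁` (exchange with an up-set rider across the conditionings `{s↔y}` / `{y↮s}`).**  For a monotone family `𝒰` of edge sets (up-set of the open edge cluster):
`μ(s↔y, s↮X, 𝒰(V C_s)) · μ(y↔z, y↮s, y↮X, s↮X) ≤ μ(y↮s, s↮z, y↮X, s↮X) · μ(s↔y, s↔z, s↮X, 𝒰(V C_s))`.
[cite: VandenbergHaggstromKahn2005, Thm. 1.1 and its proof (pp. 3–5) — instance of `Consts.localEvE_fourEvents`, derived here] -/
theorem pinnedEdge_exchange_G1 (s y z : V) (X : Set V) {𝒰 : Set (Sym2 V) → Prop} (h𝒰 : Monotone 𝒰) :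
    (prodBernoulli w).real {ω : BondConfig V | (openGraph ω).Reachable s y ∧ (∀ x ∈ X, ¬ (openGraph ω).Reachable s x) ∧
        𝒰 (openEdgeCluster ω s)} *
      (prodBernoulli w).real {ω : BondConfig V | (openGraph ω).Reachable y z ∧ ¬ (openGraph ω).Reachable y s ∧
        (∀ x ∈ X, ¬ (openGraph ω).Reachable y x) ∧ (∀ x ∈ X, ¬ (openGraph ω).Reachable s x)} ≤
    (prodBernoulli w).real {ω : BondConfig V | ¬ (openGraph ω).Reachable y s ∧ ¬ (openGraph ω).Reachable s z ∧
        (∀ x ∈ X, ¬ (openGraph ω).Reachable y x) ∧ (∀ x ∈ X, ¬ (openGraph ω).Reachable s x)} *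
      (prodBernoulli w).real {ω : BondConfig V | (openGraph ω).Reachable s y ∧ (openGraph ω).Reachable s z ∧
        (∀ x ∈ X, ¬ (openGraph ω).Reachable s x) ∧ 𝒰 (openEdgeCluster ω s)} := by
  set S : Finset V := {s, y} with hSdef
  have hsS : s ∈ S := by simp [hSdef]
  have hyS : y ∈ S := by simp [hSdef]
  have hRs : ∀ ω : BondConfig V, clusterOf S ω s = openEdgeCluster ω s := fun ω => clusterOf_apply' hsS
  have hRy : ∀ ω : BondConfig V, clusterOf S ω y = openEdgeCluster ω y := fun ω => clusterOf_apply' hyS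
  have hball : ∀ (P : V → Prop), (∀ s' ∈ S, P s') ↔ (P s ∧ P y) := fun P => by
    simp only [hSdef, Finset.mem_insert, Finset.mem_singleton, forall_eq_or_imp, forall_eq]
  let Φ₁ : (V → Set (Sym2 V)) → Prop := fun R => (y = s ∨ ∃ e ∈ R s, y ∈ e) ∧ 𝒰 (R s)
  let Φ₂ : (V → Set (Sym2 V)) → Prop := fun R => (z = y ∨ ∃ e ∈ R y, z ∈ e) ∧ ¬ (s = y ∨ ∃ e ∈ R y, s ∈ e)
  let Φ₃ : (V → Set (Sym2 V)) → Prop := fun R => ¬ (s = y ∨ ∃ e ∈ R y, s ∈ e) ∧ ¬ (z = s ∨ ∃ e ∈ R s, z ∈ e)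
  let Φ₄ : (V → Set (Sym2 V)) → Prop := fun R => (y = s ∨ ∃ e ∈ R s, y ∈ e) ∧ (z = s ∨ ∃ e ∈ R s, z ∈ e) ∧ 𝒰 (R s)
  have hAD : ∀ ω ω' : BondConfig V, Φ₁ (clusterOf S ω) → Φ₂ (clusterOf S ω') →
      Φ₃ (clusterOf (S ∩ S) (ω ∩ ω')) ∧ Φ₄ (clusterOf (S ∪ S) (ω ∪ ω')) := by
    intro ω ω' h1 h2
    simp only [Φ₁, Φ₂, Φ₃, Φ₄, Finset.inter_self, Finset.union_self, hRs, hRy, reach_iff'] at h1 h2 ⊢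
    obtain ⟨hsy, hU⟩ := h1
    obtain ⟨hyz, hys⟩ := h2
    refine ⟨⟨fun h => hys (reach_mono' Set.inter_subset_right h),
      fun h => hys (hyz.trans (reach_mono' Set.inter_subset_right h).symm)⟩,
      reach_mono' Set.subset_union_left hsy,
      (reach_mono' Set.subset_union_left hsy).trans (reach_mono' Set.subset_union_right hyz),
      h𝒰 (BHK2006.openEdgeCluster_mono Set.subset_union_left s) hU⟩
  have key := localEvE_fourEvents w S S hAD X X
  rw [Finset.inter_self, Finset.union_self, Set.union_self, Set.inter_self] at key
  have e1 : ({ω : BondConfig V | Φ₁ (clusterOf S ω)} ∩ {ω | ∀ s' ∈ S, ∀ x ∈ X, ω ∉ openConn s' x}) =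
      {ω : BondConfig V | (openGraph ω).Reachable s y ∧ (∀ x ∈ X, ¬ (openGraph ω).Reachable s x) ∧
        𝒰 (openEdgeCluster ω s)} := by
    ext ω
    simp only [Φ₁, Set.mem_inter_iff, Set.mem_setOf_eq, hRs, reach_iff', hball, openConn]
    constructor
    · rintro ⟨⟨hsy, hU⟩, hsX, -⟩
      exact ⟨hsy, hsX, hU⟩
    · rintro ⟨hsy, hsX, hU⟩
      exact ⟨⟨hsy, hU⟩, hsX, fun x hx h' => hsX x hx (hsy.trans h')⟩
  have e2 : ({ω : BondConfig V | Φ₂ (clusterOf S ω)} ∩ {ω | ∀ s' ∈ S, ∀ x ∈ X, ω ∉ openConn s' x}) =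
      {ω : BondConfig V | (openGraph ω).Reachable y z ∧ ¬ (openGraph ω).Reachable y s ∧
        (∀ x ∈ X, ¬ (openGraph ω).Reachable y x) ∧ (∀ x ∈ X, ¬ (openGraph ω).Reachable s x)} := by
    ext ω
    simp only [Φ₂, Set.mem_inter_iff, Set.mem_setOf_eq, hRy, reach_iff', hball, openConn]
    tauto
  have e3 : ({ω : BondConfig V | Φ₃ (clusterOf S ω)} ∩ {ω | ∀ s' ∈ S, ∀ x ∈ X, ω ∉ openConn s' x}) =
      {ω : BondConfig V | ¬ (openGraph ω).Reachable y s ∧ ¬ (openGraph ω).Reachable s z ∧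
        (∀ x ∈ X, ¬ (openGraph ω).Reachable y x) ∧ (∀ x ∈ X, ¬ (openGraph ω).Reachable s x)} := by
    ext ω
    simp only [Φ₃, Set.mem_inter_iff, Set.mem_setOf_eq, hRs, hRy, reach_iff', hball, openConn]
    tauto
  have e4 : ({ω : BondConfig V | Φ₄ (clusterOf S ω)} ∩ {ω | ∀ s' ∈ S, ∀ x ∈ X, ω ∉ openConn s' x}) =
      {ω : BondConfig V | (openGraph ω).Reachable s y ∧ (openGraph ω).Reachable s z ∧
        (∀ x ∈ X, ¬ (openGraph ω).Reachable s x) ∧ 𝒰 (openEdgeCluster ω s)} := by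
    ext ω
    simp only [Φ₄, Set.mem_inter_iff, Set.mem_setOf_eq, hRs, reach_iff', hball, openConn]
    constructor
    · rintro ⟨⟨hsy, hsz, hU⟩, hsX, -⟩
      exact ⟨hsy, hsz, hsX, hU⟩
    · rintro ⟨hsy, hsz, hsX, hU⟩
      exact ⟨⟨hsy, hsz, hU⟩, hsX, fun x hx h' => hsX x hx (hsy.trans h')⟩
  rw [e1, e2, e3, e4] at key
  exact key

/-- **Generator `G₂` (positive association of the cluster of `{s,y}` given `{s,y} ↮ X`, with an up-set rider).**  For a monotone
family `𝒰` of edge sets:  `μ(z ∈ C_s ∪ C_y, s↮X, y↮X) · μ(s↔y, s↮X, 𝒰(V C_s)) ≤ μ(s↮X, y↮X) · μ(s↔y, s↔z, s↮X, 𝒰(V C_s))`.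
[cite: VandenbergHaggstromKahn2005, Thm. 1.3 (p. 6) with Remark 1 after Thm. 1.2 (p. 5) — instance of `Consts.localEvE_fourEvents`, derived here] -/
theorem pinnedEdge_exchange_G2 (s y z : V) (X : Set V) {𝒰 : Set (Sym2 V) → Prop} (h𝒰 : Monotone 𝒰) :
    (prodBernoulli w).real {ω : BondConfig V | ((openGraph ω).Reachable s z ∨ (openGraph ω).Reachable y z) ∧
        (∀ x ∈ X, ¬ (openGraph ω).Reachable y x) ∧ (∀ x ∈ X, ¬ (openGraph ω).Reachable s x)} *
      (prodBernoulli w).real {ω : BondConfig V | (openGraph ω).Reachable s y ∧ (∀ x ∈ X, ¬ (openGraph ω).Reachable s x) ∧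
        𝒰 (openEdgeCluster ω s)} ≤
    (prodBernoulli w).real {ω : BondConfig V | (∀ x ∈ X, ¬ (openGraph ω).Reachable y x) ∧ (∀ x ∈ X, ¬ (openGraph ω).Reachable s x)} *
      (prodBernoulli w).real {ω : BondConfig V | (openGraph ω).Reachable s y ∧ (openGraph ω).Reachable s z ∧
        (∀ x ∈ X, ¬ (openGraph ω).Reachable s x) ∧ 𝒰 (openEdgeCluster ω s)} := by
  set S : Finset V := {s, y} with hSdef
  have hsS : s ∈ S := by simp [hSdef]
  have hyS : y ∈ S := by simp [hSdef]
  have hRs : ∀ ω : BondConfig V, clusterOf S ω s = openEdgeCluster ω s := fun ω => clusterOf_apply' hsS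
  have hRy : ∀ ω : BondConfig V, clusterOf S ω y = openEdgeCluster ω y := fun ω => clusterOf_apply' hyS
  have hball : ∀ (P : V → Prop), (∀ s' ∈ S, P s') ↔ (P s ∧ P y) := fun P => by
    simp only [hSdef, Finset.mem_insert, Finset.mem_singleton, forall_eq_or_imp, forall_eq]
  let Φ₁ : (V → Set (Sym2 V)) → Prop := fun R => (z = s ∨ ∃ e ∈ R s, z ∈ e) ∨ (z = y ∨ ∃ e ∈ R y, z ∈ e)
  let Φ₂ : (V → Set (Sym2 V)) → Prop := fun R => (y = s ∨ ∃ e ∈ R s, y ∈ e) ∧ 𝒰 (R s)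
  let Φ₃ : (V → Set (Sym2 V)) → Prop := fun _ => True
  let Φ₄ : (V → Set (Sym2 V)) → Prop := fun R => (y = s ∨ ∃ e ∈ R s, y ∈ e) ∧ (z = s ∨ ∃ e ∈ R s, z ∈ e) ∧ 𝒰 (R s)
  have hAD : ∀ ω ω' : BondConfig V, Φ₁ (clusterOf S ω) → Φ₂ (clusterOf S ω') →
      Φ₃ (clusterOf (S ∩ S) (ω ∩ ω')) ∧ Φ₄ (clusterOf (S ∪ S) (ω ∪ ω')) := by
    intro ω ω' h1 h2
    simp only [Φ₁, Φ₂, Φ₃, Φ₄, Finset.inter_self, Finset.union_self, hRs, hRy, reach_iff', true_and] at h1 h2 ⊢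
    obtain ⟨hsy, hU⟩ := h2
    refine ⟨reach_mono' Set.subset_union_right hsy, ?_,
      h𝒰 (BHK2006.openEdgeCluster_mono Set.subset_union_right s) hU⟩
    rcases h1 with hsz | hyz
    · exact reach_mono' Set.subset_union_left hsz
    · exact (reach_mono' Set.subset_union_right hsy).trans (reach_mono' Set.subset_union_left hyz)
  have key := localEvE_fourEvents w S S hAD X X
  rw [Finset.inter_self, Finset.union_self, Set.union_self, Set.inter_self] at key
  have e1 : ({ω : BondConfig V | Φ₁ (clusterOf S ω)} ∩ {ω | ∀ s' ∈ S, ∀ x ∈ X, ω ∉ openConn s' x}) =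
      {ω : BondConfig V | ((openGraph ω).Reachable s z ∨ (openGraph ω).Reachable y z) ∧
        (∀ x ∈ X, ¬ (openGraph ω).Reachable y x) ∧ (∀ x ∈ X, ¬ (openGraph ω).Reachable s x)} := by
    ext ω
    simp only [Φ₁, Set.mem_inter_iff, Set.mem_setOf_eq, hRs, hRy, reach_iff', hball, openConn]
    tauto
  have e2 : ({ω : BondConfig V | Φ₂ (clusterOf S ω)} ∩ {ω | ∀ s' ∈ S, ∀ x ∈ X, ω ∉ openConn s' x}) =
      {ω : BondConfig V | (openGraph ω).Reachable s y ∧ (∀ x ∈ X, ¬ (openGraph ω).Reachable s x) ∧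
        𝒰 (openEdgeCluster ω s)} := by
    ext ω
    simp only [Φ₂, Set.mem_inter_iff, Set.mem_setOf_eq, hRs, reach_iff', hball, openConn]
    constructor
    · rintro ⟨⟨hsy, hU⟩, hsX, -⟩
      exact ⟨hsy, hsX, hU⟩
    · rintro ⟨hsy, hsX, hU⟩
      exact ⟨⟨hsy, hU⟩, hsX, fun x hx h' => hsX x hx (hsy.trans h')⟩
  have e3 : ({ω : BondConfig V | Φ₃ (clusterOf S ω)} ∩ {ω | ∀ s' ∈ S, ∀ x ∈ X, ω ∉ openConn s' x}) =
      {ω : BondConfig V | (∀ x ∈ X, ¬ (openGraph ω).Reachable y x) ∧ (∀ x ∈ X, ¬ (openGraph ω).Reachable s x)} := by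
    ext ω
    simp only [Φ₃, Set.mem_inter_iff, Set.mem_setOf_eq, hball, openConn, true_and]
    tauto
  have e4 : ({ω : BondConfig V | Φ₄ (clusterOf S ω)} ∩ {ω | ∀ s' ∈ S, ∀ x ∈ X, ω ∉ openConn s' x}) =
      {ω : BondConfig V | (openGraph ω).Reachable s y ∧ (openGraph ω).Reachable s z ∧
        (∀ x ∈ X, ¬ (openGraph ω).Reachable s x) ∧ 𝒰 (openEdgeCluster ω s)} := by
    ext ω
    simp only [Φ₄, Set.mem_inter_iff, Set.mem_setOf_eq, hRs, reach_iff', hball, openConn]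
    constructor
    · rintro ⟨⟨hsy, hsz, hU⟩, hsX, -⟩
      exact ⟨hsy, hsz, hsX, hU⟩
    · rintro ⟨hsy, hsz, hsX, hU⟩
      exact ⟨⟨hsy, hsz, hU⟩, hsX, fun x hx h' => hsX x hx (hsy.trans h')⟩
  rw [e1, e2, e3, e4] at key
  exact key

/-- **Generator `G₃` (the same exchange with the rider `y ↮ s` on the meet side).**  For a monotone family `𝒰` of edge sets (up-set of the open edge cluster):
`μ(z ∈ C_s ∪ C_y, y↮s, s↮X, y↮X) · μ(s↔y, s↮X, 𝒰(V C_s)) ≤ μ(y↮s, s↮X, y↮X) · μ(s↔y, s↔z, s↮X, 𝒰(V C_s))`.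
[cite: VandenbergHaggstromKahn2005, Thm. 1.1 and its proof (pp. 3–5) — instance of `Consts.localEvE_fourEvents`, derived here] -/
theorem pinnedEdge_exchange_G3 (s y z : V) (X : Set V) {𝒰 : Set (Sym2 V) → Prop} (h𝒰 : Monotone 𝒰) :
    (prodBernoulli w).real {ω : BondConfig V | ((openGraph ω).Reachable s z ∨ (openGraph ω).Reachable y z) ∧
        ¬ (openGraph ω).Reachable y s ∧
        (∀ x ∈ X, ¬ (openGraph ω).Reachable y x) ∧ (∀ x ∈ X, ¬ (openGraph ω).Reachable s x)} *
      (prodBernoulli w).real {ω : BondConfig V | (openGraph ω).Reachable s y ∧ (∀ x ∈ X, ¬ (openGraph ω).Reachable s x) ∧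
        𝒰 (openEdgeCluster ω s)} ≤
    (prodBernoulli w).real {ω : BondConfig V | ¬ (openGraph ω).Reachable y s ∧
        (∀ x ∈ X, ¬ (openGraph ω).Reachable y x) ∧ (∀ x ∈ X, ¬ (openGraph ω).Reachable s x)} *
      (prodBernoulli w).real {ω : BondConfig V | (openGraph ω).Reachable s y ∧ (openGraph ω).Reachable s z ∧
        (∀ x ∈ X, ¬ (openGraph ω).Reachable s x) ∧ 𝒰 (openEdgeCluster ω s)} := by
  set S : Finset V := {s, y} with hSdef
  have hsS : s ∈ S := by simp [hSdef]
  have hyS : y ∈ S := by simp [hSdef]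
  have hRs : ∀ ω : BondConfig V, clusterOf S ω s = openEdgeCluster ω s := fun ω => clusterOf_apply' hsS
  have hRy : ∀ ω : BondConfig V, clusterOf S ω y = openEdgeCluster ω y := fun ω => clusterOf_apply' hyS
  have hball : ∀ (P : V → Prop), (∀ s' ∈ S, P s') ↔ (P s ∧ P y) := fun P => by
    simp only [hSdef, Finset.mem_insert, Finset.mem_singleton, forall_eq_or_imp, forall_eq]
  let Φ₁ : (V → Set (Sym2 V)) → Prop := fun R => ((z = s ∨ ∃ e ∈ R s, z ∈ e) ∨ (z = y ∨ ∃ e ∈ R y, z ∈ e)) ∧ ¬ (s = y ∨ ∃ e ∈ R y, s ∈ e)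
  let Φ₂ : (V → Set (Sym2 V)) → Prop := fun R => (y = s ∨ ∃ e ∈ R s, y ∈ e) ∧ 𝒰 (R s)
  let Φ₃ : (V → Set (Sym2 V)) → Prop := fun R => ¬ (s = y ∨ ∃ e ∈ R y, s ∈ e)
  let Φ₄ : (V → Set (Sym2 V)) → Prop := fun R => (y = s ∨ ∃ e ∈ R s, y ∈ e) ∧ (z = s ∨ ∃ e ∈ R s, z ∈ e) ∧ 𝒰 (R s)
  have hAD : ∀ ω ω' : BondConfig V, Φ₁ (clusterOf S ω) → Φ₂ (clusterOf S ω') →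
      Φ₃ (clusterOf (S ∩ S) (ω ∩ ω')) ∧ Φ₄ (clusterOf (S ∪ S) (ω ∪ ω')) := by
    intro ω ω' h1 h2
    simp only [Φ₁, Φ₂, Φ₃, Φ₄, Finset.inter_self, Finset.union_self, hRs, hRy, reach_iff'] at h1 h2 ⊢
    obtain ⟨hz, hys⟩ := h1
    obtain ⟨hsy, hU⟩ := h2
    refine ⟨fun h => hys (reach_mono' Set.inter_subset_left h), reach_mono' Set.subset_union_right hsy, ?_,
      h𝒰 (BHK2006.openEdgeCluster_mono Set.subset_union_right s) hU⟩
    rcases hz with hsz | hyz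
    · exact reach_mono' Set.subset_union_left hsz
    · exact (reach_mono' Set.subset_union_right hsy).trans (reach_mono' Set.subset_union_left hyz)
  have key := localEvE_fourEvents w S S hAD X X
  rw [Finset.inter_self, Finset.union_self, Set.union_self, Set.inter_self] at key
  have e1 : ({ω : BondConfig V | Φ₁ (clusterOf S ω)} ∩ {ω | ∀ s' ∈ S, ∀ x ∈ X, ω ∉ openConn s' x}) =
      {ω : BondConfig V | ((openGraph ω).Reachable s z ∨ (openGraph ω).Reachable y z) ∧
        ¬ (openGraph ω).Reachable y s ∧
        (∀ x ∈ X, ¬ (openGraph ω).Reachable y x) ∧ (∀ x ∈ X, ¬ (openGraph ω).Reachable s x)} := by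
    ext ω
    simp only [Φ₁, Set.mem_inter_iff, Set.mem_setOf_eq, hRs, hRy, reach_iff', hball, openConn]
    tauto
  have e2 : ({ω : BondConfig V | Φ₂ (clusterOf S ω)} ∩ {ω | ∀ s' ∈ S, ∀ x ∈ X, ω ∉ openConn s' x}) =
      {ω : BondConfig V | (openGraph ω).Reachable s y ∧ (∀ x ∈ X, ¬ (openGraph ω).Reachable s x) ∧
        𝒰 (openEdgeCluster ω s)} := by
    ext ω
    simp only [Φ₂, Set.mem_inter_iff, Set.mem_setOf_eq, hRs, reach_iff', hball, openConn]
    constructor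
    · rintro ⟨⟨hsy, hU⟩, hsX, -⟩
      exact ⟨hsy, hsX, hU⟩
    · rintro ⟨hsy, hsX, hU⟩
      exact ⟨⟨hsy, hU⟩, hsX, fun x hx h' => hsX x hx (hsy.trans h')⟩
  have e3 : ({ω : BondConfig V | Φ₃ (clusterOf S ω)} ∩ {ω | ∀ s' ∈ S, ∀ x ∈ X, ω ∉ openConn s' x}) =
      {ω : BondConfig V | ¬ (openGraph ω).Reachable y s ∧
        (∀ x ∈ X, ¬ (openGraph ω).Reachable y x) ∧ (∀ x ∈ X, ¬ (openGraph ω).Reachable s x)} := by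
    ext ω
    simp only [Φ₃, Set.mem_inter_iff, Set.mem_setOf_eq, hRy, reach_iff', hball, openConn]
    tauto
  have e4 : ({ω : BondConfig V | Φ₄ (clusterOf S ω)} ∩ {ω | ∀ s' ∈ S, ∀ x ∈ X, ω ∉ openConn s' x}) =
      {ω : BondConfig V | (openGraph ω).Reachable s y ∧ (openGraph ω).Reachable s z ∧
        (∀ x ∈ X, ¬ (openGraph ω).Reachable s x) ∧ 𝒰 (openEdgeCluster ω s)} := by
    ext ω
    simp only [Φ₄, Set.mem_inter_iff, Set.mem_setOf_eq, hRs, reach_iff', hball, openConn]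
    constructor
    · rintro ⟨⟨hsy, hsz, hU⟩, hsX, -⟩
      exact ⟨hsy, hsz, hsX, hU⟩
    · rintro ⟨hsy, hsz, hsX, hU⟩
      exact ⟨⟨hsy, hsz, hU⟩, hsX, fun x hx h' => hsX x hx (hsy.trans h')⟩
  rw [e1, e2, e3, e4] at key
  exact key

/-- **CROSS member `M₂` at `u = z` on the marker-pinned class, unconditionally** (`…CrossReachMarkerPinnedEvent`'s theorem with its three exchange
hypotheses discharged by `pinnedEdge_exchange_G1/G2/G3`). [cite: VandenbergHaggstromKahn2005, Thm. 1.1 (pp. 3–5), Thm. 1.4 (p. 7)] -/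
theorem crossRel_edge_M2_of_markerPinned (s y z : V) (X : Set V) (F : Set (Sym2 V) → ℝ) (hFm : Monotone F)
    (hF01 : ∀ C, F C = 0 ∨ F C = 1) (hFY : ∀ ω : BondConfig V, F (openEdgeCluster ω s) = 1 → (openGraph ω).Reachable s y) :
    0 ≤ polMargin (prodBernoulli w) s y z F (insert z X) (insert z X) X +
          polMargin (prodBernoulli w) s y z F (insert z X) X (insert z X) +
        polMargin (prodBernoulli w) s y z F X (insert z X) (insert z X) := by
  -- the up-set `𝒰 = {F = 1}` of edge clusters and the event `U = {F(C_s) = 1} ⊆ {s↔y}`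
  set 𝒰 : Set (Sym2 V) → Prop := fun C => F C = 1 with h𝒰def
  have h𝒰 : Monotone 𝒰 := by
    intro C C' hCC' hC
    have h1 : F C ≤ F C' := hFm hCC'
    rcases hF01 C' with h' | h'
    · exfalso; simp only [h𝒰def] at hC; linarith
    · exact h'
  set U : Set (BondConfig V) := {ω | 𝒰 (openEdgeCluster ω s)} with hUdef
  have hUY : U ⊆ openConn s y := fun ω hω => hFY ω hω
  have hF : ∀ ω : BondConfig V, F (openEdgeCluster ω s) = U.indicator 1 ω := by
    intro ω
    rcases hF01 (openEdgeCluster ω s) with h | h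
    · have hn : ω ∉ U := by simp only [hUdef, h𝒰def, Set.mem_setOf_eq, h]; norm_num
      rw [h, Set.indicator_of_notMem hn]
    · rw [Set.indicator_of_mem (show ω ∈ U from h), Pi.one_apply, h]
  have g1 := pinnedEdge_exchange_G1 w s y z X h𝒰
  have g2 := pinnedEdge_exchange_G2 w s y z X h𝒰
  have g3 := pinnedEdge_exchange_G3 w s y z X h𝒰
  -- identify the set-builder events with the intersections used by the core theorem
  have e_YU : {ω : BondConfig V | (openGraph ω).Reachable s y ∧ (∀ x ∈ X, ¬ (openGraph ω).Reachable s x) ∧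
        𝒰 (openEdgeCluster ω s)} =
      {ω : BondConfig V | ∀ x ∈ X, ¬ (openGraph ω).Reachable s x} ∩ openConn s y ∩ U := by
    ext ω; simp only [hUdef, Set.mem_inter_iff, Set.mem_setOf_eq, openConn]; tauto
  have e_TW : {ω : BondConfig V | (openGraph ω).Reachable y z ∧ ¬ (openGraph ω).Reachable y s ∧
        (∀ x ∈ X, ¬ (openGraph ω).Reachable y x) ∧ (∀ x ∈ X, ¬ (openGraph ω).Reachable s x)} =
      {ω : BondConfig V | ∀ x ∈ insert s X, ¬ (openGraph ω).Reachable y x} ∩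
        {ω | ∀ x ∈ X, ¬ (openGraph ω).Reachable s x} ∩ openConn y z := by
    ext ω; simp only [Set.mem_inter_iff, Set.mem_setOf_eq, Set.forall_mem_insert, openConn]; tauto
  have e_TZc : {ω : BondConfig V | ¬ (openGraph ω).Reachable y s ∧ ¬ (openGraph ω).Reachable s z ∧
        (∀ x ∈ X, ¬ (openGraph ω).Reachable y x) ∧ (∀ x ∈ X, ¬ (openGraph ω).Reachable s x)} =
      ({ω : BondConfig V | ∀ x ∈ insert s X, ¬ (openGraph ω).Reachable y x} ∩
        {ω | ∀ x ∈ X, ¬ (openGraph ω).Reachable s x}) \ openConn s z := by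
    ext ω; simp only [Set.mem_inter_iff, Set.mem_sdiff, Set.mem_setOf_eq, Set.forall_mem_insert, openConn]; tauto
  have e_YZU : {ω : BondConfig V | (openGraph ω).Reachable s y ∧ (openGraph ω).Reachable s z ∧
        (∀ x ∈ X, ¬ (openGraph ω).Reachable s x) ∧ 𝒰 (openEdgeCluster ω s)} =
      {ω : BondConfig V | ∀ x ∈ X, ¬ (openGraph ω).Reachable s x} ∩ openConn s y ∩
        U ∩ openConn s z := by
    ext ω; simp only [hUdef, Set.mem_inter_iff, Set.mem_setOf_eq, openConn]; tauto
  have e_1z : {ω : BondConfig V | ((openGraph ω).Reachable s z ∨ (openGraph ω).Reachable y z) ∧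
        (∀ x ∈ X, ¬ (openGraph ω).Reachable y x) ∧ (∀ x ∈ X, ¬ (openGraph ω).Reachable s x)} =
      {ω : BondConfig V | ∀ x ∈ X, ¬ (openGraph ω).Reachable y x} ∩ {ω | ∀ x ∈ X, ¬ (openGraph ω).Reachable s x} ∩
        (openConn s z ∪ openConn y z) := by
    ext ω; simp only [Set.mem_inter_iff, Set.mem_union, Set.mem_setOf_eq, openConn]; tauto
  have e_1 : {ω : BondConfig V | (∀ x ∈ X, ¬ (openGraph ω).Reachable y x) ∧ (∀ x ∈ X, ¬ (openGraph ω).Reachable s x)} =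
      {ω : BondConfig V | ∀ x ∈ X, ¬ (openGraph ω).Reachable y x} ∩ {ω | ∀ x ∈ X, ¬ (openGraph ω).Reachable s x} := by
    ext ω; simp only [Set.mem_inter_iff, Set.mem_setOf_eq]
  have e_Tz : {ω : BondConfig V | ((openGraph ω).Reachable s z ∨ (openGraph ω).Reachable y z) ∧
        ¬ (openGraph ω).Reachable y s ∧
        (∀ x ∈ X, ¬ (openGraph ω).Reachable y x) ∧ (∀ x ∈ X, ¬ (openGraph ω).Reachable s x)} =
      {ω : BondConfig V | ∀ x ∈ insert s X, ¬ (openGraph ω).Reachable y x} ∩ {ω | ∀ x ∈ X, ¬ (openGraph ω).Reachable s x} ∩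
        (openConn s z ∪ openConn y z) := by
    ext ω; simp only [Set.mem_inter_iff, Set.mem_union, Set.mem_setOf_eq, Set.forall_mem_insert, openConn]; tauto
  have e_T : {ω : BondConfig V | ¬ (openGraph ω).Reachable y s ∧
        (∀ x ∈ X, ¬ (openGraph ω).Reachable y x) ∧ (∀ x ∈ X, ¬ (openGraph ω).Reachable s x)} =
      {ω : BondConfig V | ∀ x ∈ insert s X, ¬ (openGraph ω).Reachable y x} ∩ {ω | ∀ x ∈ X, ¬ (openGraph ω).Reachable s x} := by
    ext ω; simp only [Set.mem_inter_iff, Set.mem_setOf_eq, Set.forall_mem_insert]; tauto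
  rw [e_YU, e_TW, e_TZc, e_YZU] at g1
  rw [e_1z, e_YU, e_1, e_YZU] at g2
  rw [e_Tz, e_YU, e_T, e_YZU] at g3
  exact crossRel_M2_of_pinnedEvent_of_exchanges w s y z X U hUY F hF g1 g2 g3

end Consts

end Summit.CriticalPhenomena.PercolationContinuityZ3.Theorems

end
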